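import Mathlib.Analysis.SpecialFunctions.Complex.Log
import Literature.NumberTheory.Transcendental.ZilberGenericClosednessProofs
import HarnessLib

/-!
# A countable algebraically closed field of infinite transcendence degree with a standard
kernel character (the ambient field for the chain construction of countable
pseudo-exponential fields)

The countable model of Zilber's axioms (B. Zilber, Ann. Pure Appl. Logic 132 (2005), §§3–5;
M. Bays, J. Kirby, Algebra & Number Theory 12 (2018), Thm 5.9: the countable strong amalgam
`M(SK)`) can be constructed as the union of a chain of kernel-preserving partial exponential
maps inside one fixed countable algebraically closed field `Ω` of characteristic zero and
infinite transcendence degree, starting from the standard kernel `q τ₀ ↦ e^{2πiq}` (the intended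
use of this file, towards `exists_isZilberField_of_aleph0_lt`). This file provides that ambient
field, packaged as

* `Literature.NumberTheory.Transcendental.AmbientData Ω` — on a field `Ω`: a map
  `ψ : ℚ → Ω` which is a homomorphism into `Ωˣ` with kernel exactly `ℤ` (the values of the
  exponential on the kernel line `ℚτ₀`: all roots of unity, coherently), and the **genericity
  supply** `gen`: over every finite subset of `Ω` there are arbitrarily long algebraically
  independent tuples (infinite transcendence degree over every finitely generated subfield);
* `exists_ambientData` — such data exist on a countable algebraically closed field `Ω : Type`
  of characteristic zero: the relative algebraic closure in `ℂ` of `ℚ(w₀, w₁, …)` for an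
  algebraically independent sequence `w` (`exists_algebraicIndependent_nat_complex`), with
  `ψ q = e^{2πiq}`.

Everything is proved; no model theory is involved.

## References

* B. Zilber, *Pseudo-exponentiation on algebraically closed fields of characteristic zero*,
  Ann. Pure Appl. Logic 132 (2005), §§3–5.
* M. Bays, J. Kirby, *Pseudo-exponential maps, variants, and quasiminimality*, Algebra & Number
  Theory 12 (2018), Thm 5.9, Thm 9.1 (the base `SK`).
-/

noncomputable section

open Set Cardinal Matroid

namespace Literature.NumberTheory.Transcendental

/-! ### The data -/

/-- **Ambient data** on a field `Ω` for the chain construction of countable pseudo-exponential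
fields: a character `ψ : ℚ → Ωˣ` with kernel exactly `ℤ` (the exponential on the standard kernel
line, `q τ₀ ↦ e^{2πiq}`), and infinite transcendence degree over every finitely generated
subfield (`gen`). [folklore] -/
structure AmbientData (Ω : Type*) [Field Ω] [CharZero Ω] where
  /-- the standard kernel character `q ↦ e^{2πiq}` -/
  ψ : ℚ → Ω
  /-- `ψ` is a homomorphism `(ℚ, +) → (Ωˣ, ·)` … -/
  ψ_add : ∀ p q, ψ (p + q) = ψ p * ψ q
  /-- … with non-zero values … -/
  ψ_ne_zero : ∀ q, ψ q ≠ 0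
  /-- … and kernel exactly `ℤ`. -/
  ψ_eq_one_iff : ∀ q, ψ q = 1 ↔ ∃ n : ℤ, (n : ℚ) = q
  /-- Over every finite subset there are arbitrarily long independent tuples in the algebraic
  matroid of `Ω/ℚ` contracted by that subset (algebraically independent over `ℚ(s)`). -/
  gen : ∀ (s : Finset Ω) (n : ℕ), ∃ u : Fin n → Ω, Function.Injective u ∧
    ((AlgebraicIndependent.matroid ℚ Ω) ／ (s : Set Ω)).Indep (Set.range u)

namespace AmbientData

variable {Ω : Type*} [Field Ω] [CharZero Ω] (A : AmbientData Ω)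

/-- `ψ 0 = 1`. [folklore] -/
theorem ψ_zero : A.ψ 0 = 1 := by
  have h := A.ψ_add 0 0
  rw [add_zero] at h
  exact (mul_eq_left₀ (A.ψ_ne_zero 0)).mp h.symm

/-- `ψ` is trivial on the integers. [folklore] -/
theorem ψ_intCast (n : ℤ) : A.ψ n = 1 := (A.ψ_eq_one_iff n).2 ⟨n, rfl⟩

/-- `ψ (-q) = (ψ q)⁻¹`. [folklore] -/
theorem ψ_neg (q : ℚ) : A.ψ (-q) = (A.ψ q)⁻¹ := by
  have h := A.ψ_add q (-q)
  rw [add_neg_cancel, ψ_zero] at h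
  exact (eq_inv_of_mul_eq_one_right h.symm)

/-- `ψ (n • q) = (ψ q) ^ n` for `n : ℕ`. [folklore] -/
theorem ψ_nsmul (n : ℕ) (q : ℚ) : A.ψ (n • q) = A.ψ q ^ n := by
  induction n with
  | zero => rw [zero_smul, pow_zero, ψ_zero]
  | succ n ih => rw [succ_nsmul, A.ψ_add, ih, pow_succ]

end AmbientData

/-! ### An algebraically independent sequence of complex numbers -/

section Sequence

/-- **An algebraically independent sequence of complex numbers** (a transcendence basis of `ℂ/ℚ`
is infinite, `ℂ` being uncountable). [folklore] -/
theorem exists_algebraicIndependent_nat_complex : ∃ w : ℕ → ℂ, AlgebraicIndependent ℚ w := by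
  obtain ⟨B, hB⟩ := exists_isTranscendenceBasis ℚ ℂ
  have hBinf : B.Infinite := by
    intro hfin
    set K : IntermediateField ℚ ℂ := IntermediateField.adjoin ℚ (range ((↑) : B → ℂ)) with hK
    haveI : Countable K := by
      rw [hK, Subtype.range_coe]
      exact WeakZPTransfer.countable_adjoin_of_finite (L₀ := ℚ) hfin
    haveI : Algebra.IsAlgebraic K ℂ := hB.isAlgebraic_field
    have h1 : #ℂ ≤ ℵ₀ :=
      (Algebra.IsAlgebraic.cardinalMk_le_max K ℂ).trans
        (max_le (Cardinal.mk_le_aleph0_iff.2 inferInstance) le_rfl)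
    rw [Cardinal.mk_complex] at h1
    exact Cardinal.aleph0_lt_continuum.not_ge h1
  let e : ℕ ↪ B := hBinf.natEmbedding B
  refine ⟨fun n => (e n : ℂ), ?_⟩
  exact hB.1.comp e e.injective

end Sequence

/-! ### The ambient subfield of `ℂ` -/

section Ambient

variable (w : ℕ → ℂ)

/-- The ambient field attached to a sequence `w`: the relative algebraic closure in `ℂ` of
`ℚ(w₀, w₁, …)`. [folklore] -/
def ambientField : IntermediateField ℚ ℂ := WeakZPTransfer.defField ℚ (range w)

/-- The ambient field is algebraically closed. [folklore] -/
instance isAlgClosed_ambientField : IsAlgClosed (ambientField w) :=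
  WeakZPTransfer.isAlgClosed_defField ℚ (range w)

/-- The ambient field is countable. [folklore] -/
instance countable_ambientField : Countable (ambientField w) := by
  set E : IntermediateField ℚ ℂ := IntermediateField.adjoin ℚ (range w) with hE
  have h1 : #E ≤ ℵ₀ := by
    change #(E.toSubfield) ≤ ℵ₀
    rw [hE, IntermediateField.adjoin_toSubfield]
    refine (Subfield.cardinalMk_closure_le_max _).trans (max_le ?_ le_rfl)
    rw [Cardinal.le_aleph0_iff_set_countable]
    exact (countable_range _).union (countable_range w)
  have h2 : #(algebraicClosure E ℂ) ≤ ℵ₀ :=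
    (Algebra.IsAlgebraic.cardinalMk_le_max E (algebraicClosure E ℂ)).trans (max_le h1 le_rfl)
  exact Cardinal.mk_le_aleph0_iff.1 h2

/-- Algebraic complex numbers lie in the ambient field. [folklore] -/
theorem mem_ambientField_of_isAlgebraic {z : ℂ} (hz : IsAlgebraic ℚ z) : z ∈ ambientField w :=
  WeakZPTransfer.mem_defField_iff.2 (hz.tower_top _)

/-- `e^{2πiq}` lies in the ambient field (it is a root of unity). [folklore] -/
theorem exp_two_pi_I_mul_mem (q : ℚ) :
    Complex.exp (2 * Real.pi * Complex.I * q) ∈ ambientField w := by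
  refine mem_ambientField_of_isAlgebraic w (IsAlgebraic.of_pow q.pos (n := q.den) ?_)
  have : Complex.exp (2 * Real.pi * Complex.I * q) ^ q.den = 1 := by
    rw [← Complex.exp_nat_mul]
    have h : (q.den : ℂ) * (2 * Real.pi * Complex.I * q) = q.num * (2 * Real.pi * Complex.I) := by
      have := Rat.mul_den_eq_num q
      have h' : ((q * q.den : ℚ) : ℂ) = (q.num : ℂ) := by exact_mod_cast this
      push_cast at h'
      linear_combination (2 * Real.pi * Complex.I) * h'
    rw [h]
    exact Complex.exp_int_mul_two_pi_mul_I q.num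
  rw [this]
  exact isAlgebraic_one

/-- The sequence `w` inside the ambient field. [folklore] -/
def ambientSeq (n : ℕ) : ambientField w :=
  ⟨w n, WeakZPTransfer.subset_defField ⟨n, rfl⟩⟩

/-- If `w` is algebraically independent then so is the sequence inside the ambient field.
[folklore] -/
theorem algebraicIndependent_ambientSeq (hw : AlgebraicIndependent ℚ w) :
    AlgebraicIndependent ℚ (ambientSeq w) :=
  AlgebraicIndependent.of_comp (ambientField w).val (by exact hw)

/-- **Genericity supply in a field with an algebraically independent sequence**: over every finite
subset `s` there are arbitrarily long tuples independent in the contraction by `s` of the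
algebraic matroid (the independent set `range ω` has infinite rank, `s` has finite rank).
[folklore] -/
theorem exists_indep_contract_of_algebraicIndependent {Ω : Type*} [Field Ω] [CharZero Ω]
    {ω : ℕ → Ω} (hω : AlgebraicIndependent ℚ ω) (s : Finset Ω) (n : ℕ) :
    ∃ u : Fin n → Ω, Function.Injective u ∧
      ((AlgebraicIndependent.matroid ℚ Ω) ／ (s : Set Ω)).Indep (Set.range u) := by
  classical
  set M := AlgebraicIndependent.matroid ℚ Ω with hM
  set W : Set Ω := range ω with hW
  have hWind : M.Indep W := by
    rw [AlgebraicIndependent.matroid_indep_iff, hW]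
    exact hω.to_subtype_range
  have hWinf : W.Infinite := infinite_range_of_injective hω.injective
  have hWrk : M.eRk W = ⊤ := by rw [hWind.eRk_eq_encard, encard_eq_top_iff]; exact hWinf
  -- `eRk s + relRank s W = eRk (s ∪ W) = ⊤`, with `eRk s` finite
  have hadd := M.relRank_add_relRank' (empty_subset (s : Set Ω)) W
  simp only [relRank_eq_eRk_contract, contract_empty] at hadd
  have htop : M.eRk ((s : Set Ω) ∪ W) = ⊤ := eq_top_iff.2 (hWrk ▸ M.eRk_mono subset_union_right)
  rw [htop] at hadd
  have hsfin : M.eRk (s : Set Ω) ≠ ⊤ :=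
    ((M.eRk_le_encard _).trans_lt (s.finite_toSet.encard_lt_top)).ne
  have hrel : (M ／ (s : Set Ω)).eRk W = ⊤ := by
    rcases eq_or_ne ((M ／ (s : Set Ω)).eRk W) ⊤ with h | h
    · exact h
    · exact absurd hadd (WithTop.add_ne_top.2 ⟨hsfin, h⟩)
  -- pick `n` independent elements
  have hle : (n : ℕ∞) ≤ (M ／ (s : Set Ω)).eRk W := by rw [hrel]; exact le_top
  obtain ⟨I, hIW, hI, hIn⟩ := Matroid.le_eRk_iff.1 hle
  have hIfin : I.Finite := finite_of_encard_eq_coe hIn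
  have h1 : (I.ncard : ℕ∞) = n := by rw [hIfin.cast_ncard_eq, hIn]
  have hcard : Nat.card I = n := by
    rw [Nat.card_coe_set_eq]; exact_mod_cast h1
  haveI : Finite I := hIfin.to_subtype
  let e : Fin n ≃ I := (Finite.equivFinOfCardEq hcard).symm
  refine ⟨fun i => (e i : Ω), fun i j hij => e.injective (Subtype.ext hij), ?_⟩
  have hrange : range (fun i => (e i : Ω)) = I := by
    ext x
    constructor
    · rintro ⟨i, rfl⟩; exact (e i).2
    · intro hx; exact ⟨e.symm ⟨x, hx⟩, by simp⟩
  rw [hrange]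
  exact hI

/-- **The ambient data on the ambient field** of an algebraically independent sequence:
`ψ q = e^{2πiq}` and the genericity supply. [folklore] -/
def ambientData (hw : AlgebraicIndependent ℚ w) : AmbientData (ambientField w) where
  ψ q := ⟨Complex.exp (2 * Real.pi * Complex.I * q), exp_two_pi_I_mul_mem w q⟩
  ψ_add p q := Subtype.ext (by
    change Complex.exp (2 * Real.pi * Complex.I * ((p + q : ℚ) : ℂ)) =
      Complex.exp (2 * Real.pi * Complex.I * p) * Complex.exp (2 * Real.pi * Complex.I * q)
    rw [← Complex.exp_add]; push_cast; ring_nf)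
  ψ_ne_zero q := fun h => Complex.exp_ne_zero _ (congrArg Subtype.val h)
  ψ_eq_one_iff q := by
    rw [Subtype.ext_iff]
    change Complex.exp (2 * Real.pi * Complex.I * q) = 1 ↔ _
    rw [Complex.exp_eq_one_iff]
    constructor
    · rintro ⟨m, hm⟩
      refine ⟨m, ?_⟩
      have : (q : ℂ) = m := by
        have h := mul_left_cancel₀ Complex.two_pi_I_ne_zero
          (show 2 * Real.pi * Complex.I * q = 2 * Real.pi * Complex.I * m by
            rw [hm]; ring)
        exact h
      exact_mod_cast this.symm
    · rintro ⟨m, rfl⟩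
      exact ⟨m, by push_cast; ring⟩
  gen := exists_indep_contract_of_algebraicIndependent (algebraicIndependent_ambientSeq w hw)

end Ambient

/-- **Existence of the ambient field**: a countable algebraically closed field of characteristic
zero (in `Type`) carrying ambient data — a standard kernel character `ψ : ℚ → Ωˣ` with kernel `ℤ`
and infinite transcendence degree over every finite subset. [folklore] -/
theorem exists_ambientData :
    ∃ (Ω : Type) (_ : Field Ω) (_ : CharZero Ω), IsAlgClosed Ω ∧ Countable Ω ∧
      Nonempty (AmbientData Ω) := by
  obtain ⟨w, hw⟩ := exists_algebraicIndependent_nat_complex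
  exact ⟨ambientField w, inferInstance, inferInstance, inferInstance, inferInstance,
    ⟨ambientData w hw⟩⟩

end Literature.NumberTheory.Transcendental

end
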